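import Literature.Computability.AlgebraicComplexity.DDS21GradedFractionsEps
import HarnessLib

/-!
# DDS21 Thm. 3.2 (de-bordering `Σ^{[k]}ΠΣ`), brick B4c (E2): the EXACT DiDIL chain
# `g_{j+1} = E(g_j / T̃_j)` and its limits `f_{j+1} = E(f_j / t_j)` (Claims 3.4 / 3.5(ii))

Theorem-only companion (cell `val-lit`, np lane, programme "M-b", brick **B4c (E2)** of
`HOME/np/MEMO-t21g12-DDS21-B4-DiDIL.md` §4, frame of lead-np RULING (132)(a): R0 graded frame,
R1 EXACT objects; assigned to this seat by RULING (135)(c)) for the DiDIL induction of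
P. Dutta, P. Dwivedi, N. Saxena, *Demystifying the border of depth-3 algebraic circuits*,
FOCS 2021, FULL VERSION `paper:galaxy-pdf-7641649743695546420` (printed line numbers `Lnnn`),
§3 "Proof of Theorem 3.2" [DuttaDwivediSaxena2022]. `DDS2021_thm_3_2` itself stays an OPEN named
fact (`DDS21BorderDepthThree.lean`); this file discharges nothing by itself.

## What is rendered

The printed induction keeps, at stage `j`, a sum `g_j = ∑_{i ∈ [k-j]} T_{i,j}` over
`R_j(x, ε)` that "approximates `f_j` correctly, i.e. `lim_{ε→0} g_j = f_j`" (hypothesis (1),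
p0030 L799–801), normalises the divisor "`T_{k-j,j} =: ε^{a_{k-j,j}} · T̃_{k-j,j}`, where `T̃` … is
not divisible by `ε`" with "`lim T̃ =: t_{k-j,j}`" (L808–809), DIVIDES by `T̃_{k-j,j}`
("`f_j/T̃ + ε·S_j/T̃ = ε^{a_{k-j,j}} + ∑_{i=1}^{k-j-1} T_{i,j}/T̃`", L810) and DERIVES
("`∂_z(f_j/T̃) + ε ∂_z(S_j/T̃) = ∑_{i=1}^{k-j-1} ∂_z(T_{i,j}/T̃)`", (3.2), L811–812), and sets
"`T_{i,j+1} := (T_{i,j}/T̃)·dlog(T_{i,j}/T̃) =: g_{j+1}` (summed), `f_{j+1} := ∂_z(f_j/t_{k-j,j})`"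
(p0031 L815–817); Claim 3.4 (the case `j = 0`, p0029 L772–785) and Claim 3.5(ii) (p0031
L819–834: "Finally, as `f_{j+1}` exists, it is obvious to see that `lim_{ε→0} g_{j+1} = f_{j+1}`")
assert that the approximation property propagates.

In the tree's frame (memo findings F2/F3 and repair R1, RULING (132)(a)): `∂_z` after the
degree-tagging map `Φ` is the EULER derivation `E` (`DDS2021.euler`, `DDS2021.eulerFrac` of the
graded-fractions toolkit `DDS21GradedFractions.lean`), the stage objects are EXACT elements of
`L = F(ε)(x) = Frac(F(ε)[x])` (no truncation "mod `z^{d_j}`", no precision bookkeeping), and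
"`lim_{ε→0}` exists and equals" is the predicate `DDS2021.EpsLim` of
`DDS21EpsIntegralFractions.lean` (the Gauss valuation ring of `F(ε)(x)` and its residue map into
`L₀ = F(x)`). In that currency Claims 3.4 / 3.5(ii) ARE the following two facts, proved here:

* §1 (any field `K`, any `K`-derivation `D` of a field `L ⊇ K`; the K-side, no `ε`):
  dividing by the NORMALISED divisor `U = T̃` instead of the divisor `T = c · U` (`c ∈ K^×`)
  rescales the derivative by the scalar, `D(g/U) = c · D(g/T)` (`derivation_div_eq_scalar_mul`),
  and the divisor's own summand dies, `D(T/U) = D(c) = 0`, so that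
  `D(g/U) = ∑_{i ≠ i₀} D(T_i/U)` for `g = ∑_i T_i`, `T = T_{i₀}` (`derivation_sum_div_eq_sum_erase`)
  — the exact form of (3.2)'s "`ε^{a_{k-j,j}}` disappears under `∂_z`". These identities are what
  turns the B4b step (brick `DDS21DiDILStep.lean`, whose `didilStep` divides by the divisor ITSELF
  and sums `D((∑_i T_i)/T_{i₀})`) into the normalised next stage `g_{j+1} = E(g_j/T̃_{i₀})`
  (`next_stage_of_step`).
* §2 (the `ε`-side): the CHAIN THEOREM `epsLim_chain` — if `lim g_0 = f_0`, every divisor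
  `U_j` is an `ε`-UNIT (`EpsLim (U j) (u j)`, `u j ≠ 0`: automatic for the unit normal form of
  `exists_unit_normalForm`), `g_{j+1} = Ψ(g_j / U_j)` and `f_{j+1} = ψ(f_j / u_j)` for ANY pair of
  maps `(Ψ, ψ)` that commutes with limits of quotients by units (hypothesis `hΨ`), then
  `lim g_j = f_j` for EVERY stage `j` (unbounded and finite-horizon forms, uniqueness of the
  residues, `IsEpsInt` corollaries, the RAW-divisor form driven by the B4b step), together with
  the stage-`0` entry point from a border depth-3 circuit `g_0 = ∑_i T_{i,0} = f + ε·S`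
  (`epsLim_stage_zero`, via `MS2021.IsEpsApprox`) and the one-term exit `g_{k-1} = T_{1,k-1}`
  handed to the end game (E3) (`epsLim_last_term`).
* §3 (the programme's instance): `Ψ = E` on `F(ε)(x)` and `ψ = E` on `F(x)` (`DDS2021.eulerFrac`),
  for which `hΨ` IS the one-step lemma `epsLim_eulerFrac_div` of the sibling file
  `DDS21GradedFractionsEps.lean` (p1 g10; CONSUMED BY NAME, not restated):
  `epsLim_didilChain_euler`, `epsLim_didilChain_euler_le`, `epsLim_didilChain_euler_of_rawStep` —
  "`lim_{ε→0} g_j = f_j`" for all stages of the Euler-DiDIL transcript, with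
  `f_{j+1} = E(f_j/t_j)` EXACTLY in `F(x)` (the export (E_j.3) of `HOME/np/MEMO-t18g10-DDS21-B5-traceback.md` §1).

* §4 (appended): the chain over a RAW iteration — brick B4b's `didilIter` divides by the raw
  divisor and never rescales (over an abstract `K` it cannot); the `ε`-good stage sums are the
  scalar multiples `λ_j · raw_j`, `λ_{j+1} = λ_j · a_j` (`a_j` the normal-form scalar of the raw
  divisor), and `epsLim_chain_of_scaledRaw(_le)` / `epsLim_didilChain_euler_of_scaledRaw(_le)` give
  their limits `f_j` directly, so no rescaled iteration is ever built; `isEpsInt_scaled_last_term`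
  is the one-term exit in that currency.

The maps `Ψ, ψ` of §2 are kept ABSTRACT on purpose: the chain is pure bookkeeping over `EpsLim`;
§3/§4 are its instantiations of record.

Honest framing: `ε`-bookkeeping glue for one brick of a published, surveyed 2021 theorem; nothing
here bears on VP versus VNP, which is NOT proved; `DDS2021_thm_3_2` and `DDS2021_thm_5_1` remain
OPEN named facts.

## References

* [DuttaDwivediSaxena2022] P. Dutta, P. Dwivedi, N. Saxena, *Demystifying the border of depth-3
  algebraic circuits*, Proc. 62nd FOCS (2021), IEEE 2022, 92–103; full version
  `paper:galaxy-pdf-7641649743695546420`, §3 proof of Thm. 3.2: base case `g_0 = ∑ T_{i,0}`,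
  `U_{i,0} = T_{i,0}`, `V = P = Q = 1` (p0028 L745–749), normal form and Divide/Derive (3.1)
  (p0028 L759 – p0029 L767), Claim 3.4 (p0029 L772–785), induction hypotheses (1)–(3)
  (p0030 L799–805), Divide/Derive (3.2) (p0030 L808–812), definability + Claim 3.5
  (p0031 L815–834), "Simplifying `T_{i,j+1}`" (p0031 L838–845).
* Tree: `DDS21EpsIntegralFractions.lean` (brick B4c (E1): `EpsLim`, `IsEpsInt`,
  `exists_unit_normalForm`, `epsLim_algebraMap_of_isEpsApprox`), `DDS21GradedFractions.lean`
  (brick B4a: `euler`, `eulerFrac`), `DDS21GradedFractionsEps.lean` (`epsLim_eulerFrac_div`),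
  `HOME/np/MEMO-t21g12-DDS21-B4-DiDIL.md` (F2, F3, R1, §4 (E2)),
  `HOME/np/MEMO-t18g10-DDS21-B5-traceback.md` §1 ((E_j.3)).
-/

noncomputable section

open MvPolynomial
open scoped BigOperators Polynomial

namespace Literature.Computability.AlgebraicComplexity

namespace DDS2021

/-! ## §1 The K-side of Divide-and-Derive: normalised divisor, the divisor's summand dies -/

section KSide

variable {K : Type*} [Field K] {L : Type*} [Field L] [Algebra K L] (D : Derivation K L L)

/-- A `K`-derivation commutes with `K`-scalars written through `algebraMap`:
`D(c · x) = c · D(x)` (folklore; the `F(ε)`-linearity of `∂_z` used throughout DDS §3).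
[cite: DuttaDwivediSaxena2022, §3 proof of Thm. 3.2, Divide/Derive (3.2) (full version p0030 L808–812)] -/
theorem derivation_algebraMap_mul (c : K) (x : L) :
    D (algebraMap K L c * x) = algebraMap K L c * D x := by
  rw [← Algebra.smul_def, ← Algebra.smul_def, D.map_smul]

/-- A `K`-derivation kills `K`-scalars: `D(c) = 0` — "`ε^{a_{k-j,j}}`" (a scalar of `F(ε)`) on the
right of the Divide line (p0030 L810) disappears after Derive (L811). (folklore)
[cite: DuttaDwivediSaxena2022, §3 proof of Thm. 3.2, (3.2) (full version p0030 L810–812)] -/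
theorem derivation_algebraMap_eq_zero (c : K) : D (algebraMap K L c) = 0 :=
  D.map_algebraMap c

/-- **Normalised versus raw divisor.** If the divisor is `T = c · U` with `c ∈ K^×` (the printed
normal form "`T_{k-j,j} =: ε^{a_{k-j,j}} · T̃_{k-j,j}`", `U = T̃`), then for every `g`,
`D(g/U) = c · D(g/T)`: dividing by the NORMALISED divisor is dividing by the divisor followed by
the scalar `c`, and `D` is `K`-linear.
[cite: DuttaDwivediSaxena2022, §3 proof of Thm. 3.2, Divide/Derive (full version p0030 L808–812)] -/
theorem derivation_div_eq_scalar_mul {c : K} (hc : c ≠ 0) {T U : L}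
    (hT : T = algebraMap K L c * U) (g : L) :
    D (g / U) = algebraMap K L c * D (g / T) := by
  have hc' : algebraMap K L c ≠ 0 := (map_ne_zero (algebraMap K L)).mpr hc
  rw [← derivation_algebraMap_mul]
  congr 1
  rw [hT]
  by_cases hU : U = 0
  · simp [hU]
  · field_simp

/-- **The divisor's own quotient is the scalar**: `T/U = c` for `T = c · U`, `U ≠ 0` — the
"`ε^{a_{k-j,j}}`" of the Divide line. [cite: DuttaDwivediSaxena2022, §3 proof of Thm. 3.2, Divide (full version p0030 L810)] -/
theorem div_eq_algebraMap_of_eq_scalar_mul {c : K} {T U : L} (hU : U ≠ 0)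
    (hT : T = algebraMap K L c * U) : T / U = algebraMap K L c := by
  rw [hT, mul_div_assoc, div_self hU, mul_one]

/-- … hence it DIES under the derivation: `D(T/U) = 0`.
[cite: DuttaDwivediSaxena2022, §3 proof of Thm. 3.2, (3.2) (full version p0030 L810–812)] -/
theorem derivation_div_self_normalForm_eq_zero {c : K} {T U : L} (hU : U ≠ 0)
    (hT : T = algebraMap K L c * U) : D (T / U) = 0 := by
  rw [div_eq_algebraMap_of_eq_scalar_mul hU hT, derivation_algebraMap_eq_zero]

/-- **Exact form of (3.2).** For a stage `T : Fin (m+1) → L` with divisor index `i₀`, divisor in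
normal form `T i₀ = c · U` (`U ≠ 0`): the derivative of the whole stage sum over the normalised
divisor is the sum of the `m` remaining derived quotients,
`D((∑_i T_i)/U) = ∑_{i ≠ i₀} D(T_i/U)` — the printed
"`∂_z(f_j/T̃) + ε ∂_z(S_j/T̃) = ∑_{i=1}^{k-j-1} ∂_z(T_{i,j}/T̃)`" with `f_j + ε S_j = g_j = ∑_i T_{i,j}`
and the divisor placed last. The remaining indices are enumerated by `Fin.succAbove i₀`.
[cite: DuttaDwivediSaxena2022, §3 proof of Thm. 3.2, (3.2) (full version p0030 L808–812)] -/
theorem derivation_sum_div_eq_sum_erase {m : ℕ} (T : Fin (m + 1) → L) (i₀ : Fin (m + 1))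
    {c : K} {U : L} (hU : U ≠ 0) (hT : T i₀ = algebraMap K L c * U) :
    D ((∑ i, T i) / U) = ∑ i : Fin m, D (T (i₀.succAbove i) / U) := by
  rw [Fin.sum_univ_succAbove T i₀, add_div, map_add, derivation_div_self_normalForm_eq_zero D hU hT,
    zero_add, Finset.sum_div, map_sum]

/-- **From the B4b step to the normalised next stage.** Brick B4b (`DDS21DiDILStep.lean`) proves
for its data that the values of the derived quotients BY THE RAW DIVISOR sum to
`S' = D((∑_i T_i)/T_{i₀})` ("the `1` dies"). With the divisor in normal form `T_{i₀} = c · U`,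
`c ≠ 0`, rescaling by the scalar gives the next stage of the printed induction,
`c · S' = D((∑_i T_i)/U) = g_{j+1}` (memo R1: `g_{j+1} := E(g_j/T̃_{m})` exactly).
[cite: DuttaDwivediSaxena2022, §3 proof of Thm. 3.2, definability of `g_{j+1}` (full version p0031 L815–817); "Simplifying T_{i,j+1}" (p0031 L838–845)] -/
theorem next_stage_of_step {g T U S' : L} {c : K} (hc : c ≠ 0)
    (hT : T = algebraMap K L c * U) (hstep : S' = D (g / T)) :
    algebraMap K L c * S' = D (g / U) := by
  rw [hstep, ← derivation_div_eq_scalar_mul D hc hT]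

/-- Scalars of `K` inside a model `L` of `K(x) = Frac K[x]`: the two spellings
`algebraMap K L c` and `algebraMap K[x] L (C c)` agree (the latter is the spelling of
`exists_unit_normalForm` and of the `ΠΣ`-ratio scalars of brick B4b). (folklore)
[cite: DuttaDwivediSaxena2022, §3 proof of Thm. 3.2, normal form "T =: ε^a · T̃" (full version p0030 L808)] -/
theorem algebraMap_C_eq_algebraMap {σ : Type*} (L' : Type*) [CommRing L'] [Algebra K L']
    [Algebra (MvPolynomial σ K) L'] [IsScalarTower K (MvPolynomial σ K) L'] (c : K) :
    algebraMap (MvPolynomial σ K) L' (C c) = algebraMap K L' c := by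
  rw [IsScalarTower.algebraMap_apply K (MvPolynomial σ K) L', MvPolynomial.algebraMap_eq]

end KSide

/-! ## §2 The `ε`-side: the chain of limits (Claims 3.4 / 3.5(ii), exact frame) -/

section Chain

variable {F : Type*} [Field F] {σ : Type*}

/-- **Stage 0.** The input border circuit "`g_0 =: ∑_{i ∈ [k]} T_{i,0}`" with "`g_0 = f + ε·S`"
(`MS2021.IsEpsApprox f g_0`, p0028 L745–748) read in `F(ε)(x)`: the stage-`0` sum of the
(images of the) terms is `ε`-integral with limit `f`.
[cite: DuttaDwivediSaxena2022, §3 proof of Thm. 3.2, base case (full version p0028 L745–749); Claim 3.4 (p0029 L772)] -/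
theorem epsLim_stage_zero {n k : ℕ} {f : MvPolynomial (Fin n) F}
    (T : Fin k → MvPolynomial (Fin n) (RatFunc F)) (h : MS2021.IsEpsApprox f (∑ i, T i)) :
    EpsLim (∑ i, algebraMap (MvPolynomial (Fin n) (RatFunc F))
        (FractionRing (MvPolynomial (Fin n) (RatFunc F))) (T i))
      (limToFrac F (Fin n) f) := by
  rw [← map_sum]
  exact epsLim_algebraMap_of_isEpsApprox h

variable {g U : ℕ → FractionRing (MvPolynomial σ (RatFunc F))}
  {f u : ℕ → FractionRing (MvPolynomial σ F)}
  {Ψ : FractionRing (MvPolynomial σ (RatFunc F)) → FractionRing (MvPolynomial σ (RatFunc F))}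
  {ψ : FractionRing (MvPolynomial σ F) → FractionRing (MvPolynomial σ F)}

/-- **The DiDIL chain of limits (Claims 3.4 / 3.5(ii), all stages).** Data: stage sums `g j`
and NORMALISED divisors `U j` in `F(ε)(x)`, candidate limits `f j`, `u j` in `F(x)`, and a pair
of maps `(Ψ, ψ)` ("Derive" upstairs and downstairs). Hypotheses: `lim g_0 = f_0` (stage 0,
`epsLim_stage_zero`); every divisor is an `ε`-unit, `lim U_j = u_j ≠ 0` (hypothesis (3) /
"`T̃` is not divisible by `ε`", "`lim T̃ =: t`"); the recursions `g_{j+1} = Ψ(g_j/U_j)`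
(definability of `g_{j+1}`, exact form, memo R1) and `f_{j+1} = ψ(f_j/u_j)`
("`f_{j+1} := ∂_z(f_j/t_{k-j,j})`"); and `hΨ`: `Ψ/ψ` commute with limits of quotients by units
(for the Euler pair: `epsLim_euler_div`, brick `DDS21GradedFractionsEps.lean`). Conclusion:
"`g_j` approximates `f_j` correctly, i.e. `lim_{ε→0} g_j = f_j`" for every `j`.
[cite: DuttaDwivediSaxena2022, Claim 3.4 (full version p0029 L772–785); Claim 3.5(ii) (p0031 L819–834); induction hypothesis (1) (p0030 L799–801)] -/
theorem epsLim_chain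
    (hΨ : ∀ (x T : FractionRing (MvPolynomial σ (RatFunc F))) (r t : FractionRing (MvPolynomial σ F)),
      EpsLim x r → EpsLim T t → t ≠ 0 → EpsLim (Ψ (x / T)) (ψ (r / t)))
    (h0 : EpsLim (g 0) (f 0)) (hU : ∀ j, EpsLim (U j) (u j)) (hu : ∀ j, u j ≠ 0)
    (hg : ∀ j, g (j + 1) = Ψ (g j / U j)) (hf : ∀ j, f (j + 1) = ψ (f j / u j)) :
    ∀ j, EpsLim (g j) (f j) := by
  intro j
  induction j with
  | zero => exact h0
  | succ j ih =>
    rw [hg j, hf j]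
    exact hΨ _ _ _ _ ih (hU j) (hu j)

/-- **Finite horizon** (the actual transcript has `k - 1` steps): with the step hypotheses only
for `j < N`, the conclusion holds for all `j ≤ N`.
[cite: DuttaDwivediSaxena2022, Claim 3.5(ii) (full version p0031 L819–834); "This process … continues for k−1 steps" (Claim 3.6 ff., p0032 L848–850)] -/
theorem epsLim_chain_le (N : ℕ)
    (hΨ : ∀ (x T : FractionRing (MvPolynomial σ (RatFunc F))) (r t : FractionRing (MvPolynomial σ F)),
      EpsLim x r → EpsLim T t → t ≠ 0 → EpsLim (Ψ (x / T)) (ψ (r / t)))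
    (h0 : EpsLim (g 0) (f 0)) (hU : ∀ j, j < N → EpsLim (U j) (u j)) (hu : ∀ j, j < N → u j ≠ 0)
    (hg : ∀ j, j < N → g (j + 1) = Ψ (g j / U j)) (hf : ∀ j, j < N → f (j + 1) = ψ (f j / u j)) :
    ∀ j, j ≤ N → EpsLim (g j) (f j) := by
  intro j
  induction j with
  | zero => exact fun _ => h0
  | succ j ih =>
    intro hj
    have hj' : j < N := Nat.lt_of_succ_le hj
    rw [hg j hj', hf j hj']
    exact hΨ _ _ _ _ (ih hj'.le) (hU j hj') (hu j hj')

/-- **The limits are determined by the transcript**: any limit of a stage sum `g j` IS `f j`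
(well-definedness `EpsLim.unique`), so a consumer may compute `f_j` from ANY model of `g_j`.
[cite: DuttaDwivediSaxena2022, Claim 3.5(ii) (full version p0031 L819–834); Claim 3.3 proof, well-definedness of lim (p0027 L729–737)] -/
theorem epsLim_chain_unique
    (hΨ : ∀ (x T : FractionRing (MvPolynomial σ (RatFunc F))) (r t : FractionRing (MvPolynomial σ F)),
      EpsLim x r → EpsLim T t → t ≠ 0 → EpsLim (Ψ (x / T)) (ψ (r / t)))
    (h0 : EpsLim (g 0) (f 0)) (hU : ∀ j, EpsLim (U j) (u j)) (hu : ∀ j, u j ≠ 0)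
    (hg : ∀ j, g (j + 1) = Ψ (g j / U j)) (hf : ∀ j, f (j + 1) = ψ (f j / u j))
    {j : ℕ} {r : FractionRing (MvPolynomial σ F)} (hr : EpsLim (g j) r) : r = f j :=
  hr.unique (epsLim_chain hΨ h0 hU hu hg hf j)

/-- Every stage sum is `ε`-integral ("`g_j` … well-defined over `R_j(x, ε)`", Claim 3.5(i) in the
exact frame: membership in the Gauss valuation ring).
[cite: DuttaDwivediSaxena2022, Claim 3.5(i) (full version p0031 L819–820)] -/
theorem isEpsInt_chain
    (hΨ : ∀ (x T : FractionRing (MvPolynomial σ (RatFunc F))) (r t : FractionRing (MvPolynomial σ F)),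
      EpsLim x r → EpsLim T t → t ≠ 0 → EpsLim (Ψ (x / T)) (ψ (r / t)))
    (h0 : EpsLim (g 0) (f 0)) (hU : ∀ j, EpsLim (U j) (u j)) (hu : ∀ j, u j ≠ 0)
    (hg : ∀ j, g (j + 1) = Ψ (g j / U j)) (hf : ∀ j, f (j + 1) = ψ (f j / u j)) (j : ℕ) :
    IsEpsInt (g j) :=
  (epsLim_chain hΨ h0 hU hu hg hf j).isEpsInt

/-- The divided stages `g_j / U_j` (before Derive) are `ε`-integral with limit `f_j / u_j`
("`(Φ(f_0)/T̃_{k,0})|_{ε=0} = Φ(f_0)/t_{k,0}`", Claim 3.4 proof, p0029 L777–779; this is what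
Claim 3.8 / brick B5 evaluates at the lowest degree).
[cite: DuttaDwivediSaxena2022, Claim 3.4 proof (full version p0029 L777–779); Claim 3.8 (p0035 L934–936)] -/
theorem epsLim_chain_div
    (hΨ : ∀ (x T : FractionRing (MvPolynomial σ (RatFunc F))) (r t : FractionRing (MvPolynomial σ F)),
      EpsLim x r → EpsLim T t → t ≠ 0 → EpsLim (Ψ (x / T)) (ψ (r / t)))
    (h0 : EpsLim (g 0) (f 0)) (hU : ∀ j, EpsLim (U j) (u j)) (hu : ∀ j, u j ≠ 0)
    (hg : ∀ j, g (j + 1) = Ψ (g j / U j)) (hf : ∀ j, f (j + 1) = ψ (f j / u j)) (j : ℕ) :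
    EpsLim (g j / U j) (f j / u j) :=
  (epsLim_chain hΨ h0 hU hu hg hf j).div (hU j) (hu j)

/-- **The chain driven by the RAW-divisor step of brick B4b.** Upstairs map = a `K`-derivation
`D` of `F(ε)(x)` (`K = F(ε)`; for the programme, `D = eulerFrac σ (RatFunc F) _`), downstairs
map `ψ` abstract. At each stage the step file supplies `S'_j = D(g_j/T_j)` for the RAW divisor
`T_j` (`sum_val_didilStep`: "the `1` dies"), the divisor is put in unit normal form
`T_j = c_j · U_j` (`exists_unit_divisor`), and the next stage is the RESCALED step output
`g_{j+1} = c_j · S'_j` (`= D(g_j/U_j)` by `next_stage_of_step`). Then every stage sum has the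
printed limit. This is the form in which the assembly consumes B4b + (E1) + the one-step
`ε`-lemma `hΨ`.
[cite: DuttaDwivediSaxena2022, §3 proof of Thm. 3.2, Divide/Derive (3.2) and definability of g_{j+1} (full version p0030 L808 – p0031 L817); Claim 3.5(ii) (p0031 L819–834)] -/
theorem epsLim_chain_of_rawStep
    (D : Derivation (RatFunc F) (FractionRing (MvPolynomial σ (RatFunc F)))
      (FractionRing (MvPolynomial σ (RatFunc F))))
    (hΨ : ∀ (x T : FractionRing (MvPolynomial σ (RatFunc F))) (r t : FractionRing (MvPolynomial σ F)),
      EpsLim x r → EpsLim T t → t ≠ 0 → EpsLim (D (x / T)) (ψ (r / t)))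
    (h0 : EpsLim (g 0) (f 0))
    {T S' : ℕ → FractionRing (MvPolynomial σ (RatFunc F))} {c : ℕ → RatFunc F}
    (hc : ∀ j, c j ≠ 0)
    (hT : ∀ j, T j = algebraMap (RatFunc F) (FractionRing (MvPolynomial σ (RatFunc F))) (c j) * U j)
    (hU : ∀ j, EpsLim (U j) (u j)) (hu : ∀ j, u j ≠ 0)
    (hS : ∀ j, S' j = D (g j / T j))
    (hg : ∀ j, g (j + 1) = algebraMap (RatFunc F) (FractionRing (MvPolynomial σ (RatFunc F))) (c j) * S' j)
    (hf : ∀ j, f (j + 1) = ψ (f j / u j)) :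
    ∀ j, EpsLim (g j) (f j) :=
  epsLim_chain (Ψ := D) hΨ h0 hU hu (fun j => by rw [hg j, next_stage_of_step D (hc j) (hT j) (hS j)]) hf

/-- **One-term exit to the end game (E3).** When a stage has a single summand
(`T : Fin 1 → L`, "`g_{k-1} ∈ Gen(1, ·)`"), that summand IS the stage sum, so it inherits the
limit: `lim T_{1,k-1} = f_{k-1}` — the input of Claim 3.3 / `deborder_gen_one`.
[cite: DuttaDwivediSaxena2022, §3 proof of Thm. 3.2, "(1) f_1 ∈ Gen(k−1,·)" roadmap (full version p0030 L789–791); Claim 3.3 (p0027 L724)] -/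
theorem epsLim_last_term (T : Fin 1 → FractionRing (MvPolynomial σ (RatFunc F)))
    {r : FractionRing (MvPolynomial σ F)} (h : EpsLim (∑ i, T i) r) : EpsLim (T 0) r := by
  rwa [Fin.sum_univ_one] at h

/-- The divisor datum of the chain from the tree's unit normal form: for a nonzero divisor
`T`, `exists_unit_normalForm` gives `T = C c · U` with `c ≠ 0` and `U` an `ε`-unit
(`EpsLim U u`, `u ≠ 0`) — exactly the hypotheses `hU`, `hu` of `epsLim_chain` at one stage, in
the `algebraMap K L c` spelling of §1.
[cite: DuttaDwivediSaxena2022, §3 proof of Thm. 3.2, normal form "T_{k-j,j} =: ε^a · T̃, lim T̃ =: t" (full version p0030 L808–809)] -/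
theorem exists_unit_divisor {T : FractionRing (MvPolynomial σ (RatFunc F))} (hT : T ≠ 0) :
    ∃ (c : RatFunc F) (U : FractionRing (MvPolynomial σ (RatFunc F)))
      (u : FractionRing (MvPolynomial σ F)), c ≠ 0 ∧ u ≠ 0 ∧ EpsLim U u ∧
      T = algebraMap (RatFunc F) (FractionRing (MvPolynomial σ (RatFunc F))) c * U := by
  obtain ⟨c, U, u, hc, hu, hU, hTU⟩ := exists_unit_normalForm hT
  exact ⟨c, U, u, hc, hu, hU, by rwa [algebraMap_C_eq_algebraMap] at hTU⟩

end Chain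

/-! ## §3 The instance of record: Derive = the Euler derivation (`∂_z` after `Φ`, memo F2)

Upstairs `E = eulerFrac σ (RatFunc F) (F(ε)(x))`, downstairs `E₀ = eulerFrac σ F (F(x))`; the
hypothesis `hΨ` of §2 is the one-step lemma `epsLim_eulerFrac_div` (brick
`DDS21GradedFractionsEps.lean`, consumed by name). -/

section EulerChain

variable {F : Type*} [Field F] {σ : Type*}
variable {g U : ℕ → FractionRing (MvPolynomial σ (RatFunc F))}
  {f u : ℕ → FractionRing (MvPolynomial σ F)}

/-- **Claims 3.4 / 3.5(ii), all stages, Euler frame.** For the exact Euler-DiDIL transcript —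
`lim g_0 = f_0`, `ε`-unit divisors `U_j` with `lim U_j = u_j ≠ 0`,
`g_{j+1} = E(g_j / U_j)` in `F(ε)(x)` and `f_{j+1} = E(f_j / u_j)` in `F(x)` — every stage sum
approximates its printed limit: `lim_{ε→0} g_j = f_j`.
[cite: DuttaDwivediSaxena2022, Claim 3.4 (full version p0029 L772–785); Claim 3.5(ii) (p0031 L819–834); f_{j+1} := ∂_z(f_j/t_{k-j,j}) (p0031 L817)] -/
theorem epsLim_didilChain_euler
    (h0 : EpsLim (g 0) (f 0)) (hU : ∀ j, EpsLim (U j) (u j)) (hu : ∀ j, u j ≠ 0)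
    (hg : ∀ j, g (j + 1) =
      eulerFrac σ (RatFunc F) (FractionRing (MvPolynomial σ (RatFunc F))) (g j / U j))
    (hf : ∀ j, f (j + 1) = eulerFrac σ F (FractionRing (MvPolynomial σ F)) (f j / u j)) :
    ∀ j, EpsLim (g j) (f j) :=
  epsLim_chain (Ψ := eulerFrac σ (RatFunc F) (FractionRing (MvPolynomial σ (RatFunc F))))
    (ψ := eulerFrac σ F (FractionRing (MvPolynomial σ F)))
    (fun _ _ _ _ hx hT ht => epsLim_eulerFrac_div hx hT ht) h0 hU hu hg hf

/-- Finite-horizon form of `epsLim_didilChain_euler` (the transcript has `N = k - 1` steps).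
[cite: DuttaDwivediSaxena2022, Claim 3.5(ii) (full version p0031 L819–834)] -/
theorem epsLim_didilChain_euler_le (N : ℕ)
    (h0 : EpsLim (g 0) (f 0)) (hU : ∀ j, j < N → EpsLim (U j) (u j)) (hu : ∀ j, j < N → u j ≠ 0)
    (hg : ∀ j, j < N → g (j + 1) =
      eulerFrac σ (RatFunc F) (FractionRing (MvPolynomial σ (RatFunc F))) (g j / U j))
    (hf : ∀ j, j < N → f (j + 1) = eulerFrac σ F (FractionRing (MvPolynomial σ F)) (f j / u j)) :
    ∀ j, j ≤ N → EpsLim (g j) (f j) :=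
  epsLim_chain_le (Ψ := eulerFrac σ (RatFunc F) (FractionRing (MvPolynomial σ (RatFunc F))))
    (ψ := eulerFrac σ F (FractionRing (MvPolynomial σ F))) N
    (fun _ _ _ _ hx hT ht => epsLim_eulerFrac_div hx hT ht) h0 hU hu hg hf

/-- **Euler chain driven by the B4b step** (`sum_val_didilStep_euler`: `S'_j = E(g_j/T_j)` for
the RAW divisor `T_j = c_j · U_j`, next stage `g_{j+1} = c_j · S'_j`): every stage sum has the
printed limit, `f_{j+1} = E(f_j/u_j)`.
[cite: DuttaDwivediSaxena2022, §3 proof of Thm. 3.2, Divide/Derive (3.2) and definability of g_{j+1} (full version p0030 L808 – p0031 L817); Claim 3.5(ii) (p0031 L819–834)] -/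
theorem epsLim_didilChain_euler_of_rawStep
    (h0 : EpsLim (g 0) (f 0))
    {T S' : ℕ → FractionRing (MvPolynomial σ (RatFunc F))} {c : ℕ → RatFunc F}
    (hc : ∀ j, c j ≠ 0)
    (hT : ∀ j, T j = algebraMap (RatFunc F) (FractionRing (MvPolynomial σ (RatFunc F))) (c j) * U j)
    (hU : ∀ j, EpsLim (U j) (u j)) (hu : ∀ j, u j ≠ 0)
    (hS : ∀ j, S' j =
      eulerFrac σ (RatFunc F) (FractionRing (MvPolynomial σ (RatFunc F))) (g j / T j))
    (hg : ∀ j, g (j + 1) =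
      algebraMap (RatFunc F) (FractionRing (MvPolynomial σ (RatFunc F))) (c j) * S' j)
    (hf : ∀ j, f (j + 1) = eulerFrac σ F (FractionRing (MvPolynomial σ F)) (f j / u j)) :
    ∀ j, EpsLim (g j) (f j) :=
  epsLim_chain_of_rawStep (ψ := eulerFrac σ F (FractionRing (MvPolynomial σ F)))
    (eulerFrac σ (RatFunc F) (FractionRing (MvPolynomial σ (RatFunc F))))
    (fun _ _ _ _ hx hT ht => epsLim_eulerFrac_div hx hT ht) h0 hc hT hU hu hS hg hf

/-- The Euler derivative of a `K`-scalar multiple, in the `C`-spelling of the normal form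
(`exists_unit_normalForm`, B4b's `PiRatio` scalars): `E(C c · x) = C c · E x`.
[cite: DuttaDwivediSaxena2022, §3 proof of Thm. 3.2, (3.2) (full version p0030 L808–812)] -/
theorem eulerFrac_algebraMap_C_mul {K : Type*} [Field K] (c : K)
    (x : FractionRing (MvPolynomial σ K)) :
    eulerFrac σ K (FractionRing (MvPolynomial σ K))
        (algebraMap (MvPolynomial σ K) (FractionRing (MvPolynomial σ K)) (C c) * x) =
      algebraMap (MvPolynomial σ K) (FractionRing (MvPolynomial σ K)) (C c) *
        eulerFrac σ K (FractionRing (MvPolynomial σ K)) x := by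
  rw [algebraMap_C_eq_algebraMap (K := K) (FractionRing (MvPolynomial σ K)) c,
    derivation_algebraMap_mul]

end EulerChain

/-! ## §4 The chain over a RAW Divide-and-Derive iteration (no `ε`-rescaling of the objects)

Brick B4b iterates the step with the RAW divisor (`didilIter`: `raw_{j+1} = D(raw_j / T_j)`, `T_j`
a term of the raw stage family), never rescaling by the `ε`-normal-form scalar — over an abstract
field `K` it cannot. The raw sums are NOT `ε`-integral in general (the scalar "`ε^{-a_{k-j,j}}`"
of "Simplifying `T_{i,j+1}`", full version p0031 L838–843, accumulates), but the printed
(`ε`-good) stage sums are EXACTLY scalar multiples of them: if `T_j = C(a_j) · U_j` is the unit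
normal form of the raw divisor and `λ_0 = 1`, `λ_{j+1} = λ_j · a_j`, then `g_j := λ_j · raw_j`
satisfies `g_{j+1} = D(g_j / U_j)` (`K`-linearity of `D`), so the chain theorem applies to it. Hence
consumers read the residues `f_j` directly off the raw iteration; no second, rescaled iteration is
ever built. -/

section ScaledRaw

variable {F : Type*} [Field F] {σ : Type*}
variable {raw Traw U : ℕ → FractionRing (MvPolynomial σ (RatFunc F))}
  {f u : ℕ → FractionRing (MvPolynomial σ F)} {a lam : ℕ → RatFunc F}
  {ψ : FractionRing (MvPolynomial σ F) → FractionRing (MvPolynomial σ F)}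

/-- **The rescaling identity along a raw iteration**: with `T_j = a_j · U_j`,
`raw_{j+1} = D(raw_j/T_j)` and `λ_{j+1} = λ_j · a_j`, the scaled sums `g_j = λ_j · raw_j` obey the
normalised recursion `g_{j+1} = D(g_j / U_j)`.
[cite: DuttaDwivediSaxena2022, §3 proof of Thm. 3.2, Divide/Derive (3.2) (full version p0030 L808–812); "Simplifying T_{i,j+1}", the scalar ε^{-a_{k-j,j}} (p0031 L838–843)] -/
theorem scaledRaw_succ
    (D : Derivation (RatFunc F) (FractionRing (MvPolynomial σ (RatFunc F)))
      (FractionRing (MvPolynomial σ (RatFunc F))))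
    (ha : ∀ j, a j ≠ 0)
    (hT : ∀ j, Traw j = algebraMap (RatFunc F) (FractionRing (MvPolynomial σ (RatFunc F))) (a j) * U j)
    (hraw : ∀ j, raw (j + 1) = D (raw j / Traw j))
    (hlam : ∀ j, lam (j + 1) = lam j * a j) (j : ℕ) :
    algebraMap (RatFunc F) (FractionRing (MvPolynomial σ (RatFunc F))) (lam (j + 1)) * raw (j + 1) =
      D ((algebraMap (RatFunc F) (FractionRing (MvPolynomial σ (RatFunc F))) (lam j) * raw j) / U j) := by
  rw [hlam j, map_mul, mul_assoc, hraw j, ← derivation_div_eq_scalar_mul D (ha j) (hT j) (raw j),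
    mul_div_assoc, derivation_algebraMap_mul]

/-- **The DiDIL chain over a RAW iteration (abstract downstairs map `ψ`).** Raw stage sums
`raw_{j+1} = D(raw_j / T_j)` (B4b's `didilIter` / `sum_val_didilIter_succ`), unit normal forms of
the raw divisors `T_j = a_j · U_j` (`lim U_j = u_j ≠ 0`, `exists_unit_divisor`), scalars
`λ_0 = 1`, `λ_{j+1} = λ_j · a_j`, and the one-step `ε`-lemma `hΨ` for `(D, ψ)`: then the SCALED raw
sums have the printed limits, `lim (λ_j · raw_j) = f_j` with `f_{j+1} = ψ(f_j / u_j)` — Claims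
3.4 / 3.5(ii) for the objects B4b actually builds.
[cite: DuttaDwivediSaxena2022, Claim 3.4 (full version p0029 L772–785); Claim 3.5(ii) (p0031 L819–834); Divide/Derive (3.2) (p0030 L808–812)] -/
theorem epsLim_chain_of_scaledRaw
    (D : Derivation (RatFunc F) (FractionRing (MvPolynomial σ (RatFunc F)))
      (FractionRing (MvPolynomial σ (RatFunc F))))
    (hΨ : ∀ (x T : FractionRing (MvPolynomial σ (RatFunc F))) (r t : FractionRing (MvPolynomial σ F)),
      EpsLim x r → EpsLim T t → t ≠ 0 → EpsLim (D (x / T)) (ψ (r / t)))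
    (h0 : EpsLim (raw 0) (f 0)) (ha : ∀ j, a j ≠ 0)
    (hT : ∀ j, Traw j = algebraMap (RatFunc F) (FractionRing (MvPolynomial σ (RatFunc F))) (a j) * U j)
    (hU : ∀ j, EpsLim (U j) (u j)) (hu : ∀ j, u j ≠ 0)
    (hraw : ∀ j, raw (j + 1) = D (raw j / Traw j))
    (hlam0 : lam 0 = 1) (hlam : ∀ j, lam (j + 1) = lam j * a j)
    (hf : ∀ j, f (j + 1) = ψ (f j / u j)) :
    ∀ j, EpsLim (algebraMap (RatFunc F) (FractionRing (MvPolynomial σ (RatFunc F))) (lam j) * raw j)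
      (f j) :=
  epsLim_chain (Ψ := D)
    (g := fun j => algebraMap (RatFunc F) (FractionRing (MvPolynomial σ (RatFunc F))) (lam j) * raw j)
    hΨ (by simpa [hlam0] using h0) hU hu (fun j => scaledRaw_succ D ha hT hraw hlam j) hf

/-- Finite-horizon form of `epsLim_chain_of_scaledRaw` (`N` rounds).
[cite: DuttaDwivediSaxena2022, Claim 3.5(ii) (full version p0031 L819–834)] -/
theorem epsLim_chain_of_scaledRaw_le (N : ℕ)
    (D : Derivation (RatFunc F) (FractionRing (MvPolynomial σ (RatFunc F)))
      (FractionRing (MvPolynomial σ (RatFunc F))))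
    (hΨ : ∀ (x T : FractionRing (MvPolynomial σ (RatFunc F))) (r t : FractionRing (MvPolynomial σ F)),
      EpsLim x r → EpsLim T t → t ≠ 0 → EpsLim (D (x / T)) (ψ (r / t)))
    (h0 : EpsLim (raw 0) (f 0)) (ha : ∀ j, j < N → a j ≠ 0)
    (hT : ∀ j, j < N →
      Traw j = algebraMap (RatFunc F) (FractionRing (MvPolynomial σ (RatFunc F))) (a j) * U j)
    (hU : ∀ j, j < N → EpsLim (U j) (u j)) (hu : ∀ j, j < N → u j ≠ 0)
    (hraw : ∀ j, j < N → raw (j + 1) = D (raw j / Traw j))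
    (hlam0 : lam 0 = 1) (hlam : ∀ j, j < N → lam (j + 1) = lam j * a j)
    (hf : ∀ j, j < N → f (j + 1) = ψ (f j / u j)) :
    ∀ j, j ≤ N →
      EpsLim (algebraMap (RatFunc F) (FractionRing (MvPolynomial σ (RatFunc F))) (lam j) * raw j)
        (f j) := by
  refine epsLim_chain_le (Ψ := D)
    (g := fun j => algebraMap (RatFunc F) (FractionRing (MvPolynomial σ (RatFunc F))) (lam j) * raw j)
    N hΨ (by simpa [hlam0] using h0) hU hu (fun j hj => ?_) hf
  show algebraMap (RatFunc F) _ (lam (j + 1)) * raw (j + 1) = D ((algebraMap (RatFunc F) _ (lam j) * raw j) / U j)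
  rw [hlam j hj, map_mul, mul_assoc, hraw j hj, ← derivation_div_eq_scalar_mul D (ha j hj) (hT j hj) (raw j),
    mul_div_assoc, derivation_algebraMap_mul]

/-- **Euler form** of `epsLim_chain_of_scaledRaw` (`D = E` on `F(ε)(x)`, `ψ = E` on `F(x)`; the
one-step lemma is `epsLim_eulerFrac_div`): for B4b's Euler iteration `didilIter (euler …)`, the
scaled raw stage sums approximate `f_j`, `f_{j+1} = E(f_j / u_j)`.
[cite: DuttaDwivediSaxena2022, Claim 3.4 (full version p0029 L772–785); Claim 3.5(ii) (p0031 L819–834); f_{j+1} := ∂_z(f_j/t_{k-j,j}) (p0031 L817)] -/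
theorem epsLim_didilChain_euler_of_scaledRaw
    (h0 : EpsLim (raw 0) (f 0)) (ha : ∀ j, a j ≠ 0)
    (hT : ∀ j, Traw j = algebraMap (RatFunc F) (FractionRing (MvPolynomial σ (RatFunc F))) (a j) * U j)
    (hU : ∀ j, EpsLim (U j) (u j)) (hu : ∀ j, u j ≠ 0)
    (hraw : ∀ j, raw (j + 1) =
      eulerFrac σ (RatFunc F) (FractionRing (MvPolynomial σ (RatFunc F))) (raw j / Traw j))
    (hlam0 : lam 0 = 1) (hlam : ∀ j, lam (j + 1) = lam j * a j)
    (hf : ∀ j, f (j + 1) = eulerFrac σ F (FractionRing (MvPolynomial σ F)) (f j / u j)) :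
    ∀ j, EpsLim (algebraMap (RatFunc F) (FractionRing (MvPolynomial σ (RatFunc F))) (lam j) * raw j)
      (f j) :=
  epsLim_chain_of_scaledRaw (ψ := eulerFrac σ F (FractionRing (MvPolynomial σ F)))
    (eulerFrac σ (RatFunc F) (FractionRing (MvPolynomial σ (RatFunc F))))
    (fun _ _ _ _ hx hT' ht => epsLim_eulerFrac_div hx hT' ht) h0 ha hT hU hu hraw hlam0 hlam hf

/-- Finite-horizon Euler form (`N = k - 1` rounds of B4b's `didilIter (euler …)`).
[cite: DuttaDwivediSaxena2022, Claim 3.5(ii) (full version p0031 L819–834)] -/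
theorem epsLim_didilChain_euler_of_scaledRaw_le (N : ℕ)
    (h0 : EpsLim (raw 0) (f 0)) (ha : ∀ j, j < N → a j ≠ 0)
    (hT : ∀ j, j < N →
      Traw j = algebraMap (RatFunc F) (FractionRing (MvPolynomial σ (RatFunc F))) (a j) * U j)
    (hU : ∀ j, j < N → EpsLim (U j) (u j)) (hu : ∀ j, j < N → u j ≠ 0)
    (hraw : ∀ j, j < N → raw (j + 1) =
      eulerFrac σ (RatFunc F) (FractionRing (MvPolynomial σ (RatFunc F))) (raw j / Traw j))
    (hlam0 : lam 0 = 1) (hlam : ∀ j, j < N → lam (j + 1) = lam j * a j)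
    (hf : ∀ j, j < N → f (j + 1) = eulerFrac σ F (FractionRing (MvPolynomial σ F)) (f j / u j)) :
    ∀ j, j ≤ N →
      EpsLim (algebraMap (RatFunc F) (FractionRing (MvPolynomial σ (RatFunc F))) (lam j) * raw j)
        (f j) :=
  epsLim_chain_of_scaledRaw_le (ψ := eulerFrac σ F (FractionRing (MvPolynomial σ F))) N
    (eulerFrac σ (RatFunc F) (FractionRing (MvPolynomial σ (RatFunc F))))
    (fun _ _ _ _ hx hT' ht => epsLim_eulerFrac_div hx hT' ht) h0 ha hT hU hu hraw hlam0 hlam hf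

/-- **The last raw term de-borders after ONE scalar**: if after the rounds a single raw term
`R` remains (`raw_N = R`, one summand), then `λ_N · R` is `ε`-integral with limit `f_N` — so the
end game (E3) normalises `R` itself: `R = C c · R̃` with `R̃` an `ε`-unit iff `λ_N · c` has order
`0`, and in all cases `IsEpsInt (λ_N · R)` is the hypothesis shape of `deborder_exactTerm` /
`IsEpsInt.exists_ord_of_normalForm`.
[cite: DuttaDwivediSaxena2022, Claim 3.3 proof "it must happen that val_ε(…) ≥ 0" (full version p0027 L729–735); roadmap "(1) f_1 ∈ Gen(k−1,·)" (p0030 L789–791)] -/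
theorem isEpsInt_scaled_last_term (T : Fin 1 → FractionRing (MvPolynomial σ (RatFunc F)))
    {c : RatFunc F} {r : FractionRing (MvPolynomial σ F)}
    (h : EpsLim (algebraMap (RatFunc F) (FractionRing (MvPolynomial σ (RatFunc F))) c * ∑ i, T i) r) :
    EpsLim (algebraMap (RatFunc F) (FractionRing (MvPolynomial σ (RatFunc F))) c * T 0) r ∧
      IsEpsInt (algebraMap (RatFunc F) (FractionRing (MvPolynomial σ (RatFunc F))) c * T 0) := by
  rw [Fin.sum_univ_one] at h
  exact ⟨h, h.isEpsInt⟩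

end ScaledRaw

end DDS2021

end Literature.Computability.AlgebraicComplexity

end
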